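import Summits.Ventures.YMGap.Thresholds.StarWindowBoundWeight
import Summits.Ventures.YMGap.Thresholds.OneLinkTiltStability
import HarnessLib

/-!
# Venture YMGap — ROBUST-BALL (Y2), crux Y2-X2 for plaquette-local members: the robust STAR window and torus
# clustering for single-plaquette class-function actions `∏_q v_β(U_q) e^{−f(U_q)}` near the Wilson action

HONEST FRAMING: venture file (cell `pub-ymgap`, seat ds-4), strong-coupling LATTICE bookkeeping for `SU(N)` lattice
gauge theory on the torus `(ℤ/L)^d` (`L ≥ 3`) with the plaquette weight `v = v_β · e^{−f}` (`v_β` the Wilson weight at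
tree coupling `β`, `f` a continuous class function on `SU(N)` invariant under inversion — e.g. any real combination of
characters `Σ_r c_r Re χ_r`: mixed fundamental/adjoint actions); nothing about the continuum, confinement at weak
coupling, or a Clay-sense mass gap.  No perturbed specification on `ℤ^d` and no DLR uniqueness is claimed here
(that currency is rb-p1's `RobustBall/…`); the currency of this file is TORUS clustering uniform in the side `L`.

THE ARGUMENT (HOME/ds/ds4/ROBUST-TILT.md §5, HOME/rb/ROBUST-BALL-DESIGN.md §8 S6).  The one-link conditional law of
`torusWeightSpec v` at a link `e` with exterior `ω` is the Wilson one-link law `ν_{B_ω}` (`B_ω = tField β e ω`,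
`siteLaw_torusWilson_thooft`) RE-WEIGHTED by `e^{−h_ω}`, `h_ω(g) = Σ_{q ∋ e} f(g · T_q^e(ω))` (`siteLaw_plaquetteAction`;
the class-function and inversion invariance of `f` turn `f(U_q(ω^{e←g}))` into `f(g · staple)` at every position of
`e` in `q`, `apply_tholonomy_update`).  Its LOADS: oscillation `≤ 2(d−1)·a₀` and self-Lipschitz constant `≤ 2(d−1)·λ`
(`a₀ ≥ osc f`, `λ ≥ Lip_F f`; `2(d−1)` plaquettes through a link), and CROSS dependence
`|h_ω(g) − h_η(g)| ≤ λ · n(e,y) · ‖ω_y − η_y‖_F` through the torus influence count `n = tInfluence` ONLY — the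
perturbed influence matrix has exactly Wilson's support.  Hence, by the robust one-link lemma
(`OneLinkTiltStability.su_oneLink_robust_influence`: ANY one-link modulus `OneLinkKRModulus N R K` transfers with
the factor `e^δ (1 + 2√N ℓ)`, plus the Grüss cross leg `√N · s`):

  `isKRContraction_plaquetteAction`: `IsKRContraction (torusWeightSpec v) suFrobDist linkNbrT (c_eff · tInfluence)`,
  `c_eff = K e^{2(d−1)a₀} (1 + 2√N · 2(d−1)λ) · |β|/N + √N · λ`,

and the GENERIC-WEIGHT LEMMA G (`StarLemmaGWeight.star_window_of_isKRContraction`) applies VERBATIM with `c ↦ c_eff`: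
`plaquetteAction_star_window` (door `doorPoly d c_eff < 1`, received sum `R_G^{(d)}(c_eff)`), whence the any-`d` torus
door `DSWindow.star_abs_covariance_le` gives `plaquetteAction_abs_covariance_le`: exponential clustering of link
observables under the perturbed torus measure `Z⁻¹ ∏_q v(U_q) ∏ dU`, constants depending on `(d, N, c_eff)` only —
uniform in `L ≥ 3`.  No new resolvent / super-solution is needed for plaquette-local members; off-column entries (the
open part of crux Y2-X2) arise only for perturbations supported on polymers larger than a plaquette.

References: the tree files named above (followed line by line); R. L. Dobrushin, S. B. Shlosman (1985); H. Föllmer,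
LNM 1362 (1988) Ch. I; H.-O. Georgii (1988) Ch. 8.
-/

noncomputable section

open MeasureTheory ProbabilityTheory Function Finset Real
open Literature.Probability.LatticeModels
open Literature.Probability.LatticeModels.DobrushinMetric
open Literature.MathematicalPhysics.QuantumLattice (continuous_plaquetteHolonomy groupHeatKernelMeasure)
open Literature.MathematicalPhysics.QuantumFieldTheory
open Literature.MathematicalPhysics.QuantumFieldTheory.Balaban1983to89.StrongCouplingDobrushinWindow (OneLinkKRModulus)
open Literature.MathematicalPhysics.QuantumFieldTheory.Balaban1983to89.StrongCouplingTorusWindow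
open Summit.Ventures.YMGap.DSWindow
open Summit.Ventures.YMGap.StarKernel
open Summit.Ventures.YMGap.StarResolventDim (gaugeR doorPoly Delta_pos_of_door gaugeR_lt_one_of_door)
open Summit.Ventures.YMGap.StarLemmaGDim
open Summit.Ventures.YMGap.StarLemmaGSUN (wilsonPlaqWeight_conj suFrobDist_mul_mul)
open Summit.Ventures.YMGap.OneLinkTiltStability

namespace Summit.Ventures.YMGap.PlaquetteActionWindow

variable {d L N : ℕ} [NeZero L]

/-! ### §1 The plaquette term at a link: `f(U_q(ω^{e←g})) = f(g · T_q^e(ω))` for an inversion-invariant class function -/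

/-- **The perturbation sees the kicked link through the staple**: for a class function `f` on `SU(N)` invariant under
inversion, a plaquette `q ∋ e` and torus side `L ≥ 2`, `f(U_q(ω^{e←g})) = f(g · T_q^e(ω))` — at the four positions of
`e` in `q` the holonomy is, respectively, `g·T`, a conjugate of `g·T`, a conjugate of `(g·T)⁻¹`, and `(g·T)⁻¹`
(same case analysis as `re_trace_tholonomy_update`). [folklore] -/
theorem apply_tholonomy_update (hL : 1 < L) {f : Matrix.specialUnitaryGroup (Fin N) ℂ → ℝ}
    (hfconj : ∀ g h : Matrix.specialUnitaryGroup (Fin N) ℂ, f (g * h * g⁻¹) = f h)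
    (hfinv : ∀ h : Matrix.specialUnitaryGroup (Fin N) ℂ, f h⁻¹ = f h)
    {q : Plaquette d L} {e : Edge d L} (he : e ∈ plaqEdgesT q)
    (ω : GaugeConfig d L (Matrix.specialUnitaryGroup (Fin N) ℂ)) (g : Matrix.specialUnitaryGroup (Fin N) ℂ) :
    f (plaquetteHolonomy (update ω e g) q.1 q.2.1.1 q.2.1.2) = f (g * tstaple q e ω) := by
  rw [plaquetteHolonomy_eq_links]
  have h12 := tLink1_ne_tLink2 q
  have h13 := tLink1_ne_tLink3 hL q
  have h14 := tLink1_ne_tLink4 q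
  have h23 := tLink2_ne_tLink3 q
  have h24 := tLink2_ne_tLink4 hL q
  have h34 := tLink3_ne_tLink4 q
  rw [plaqEdgesT_eq] at he
  simp only [Finset.mem_insert, Finset.mem_singleton] at he
  unfold tstaple
  rcases he with rfl | rfl | rfl | rfl
  · simp only [if_true, update_self, update_of_ne h12.symm, update_of_ne h13.symm, update_of_ne h14.symm,
      mul_assoc]
  · simp only [if_neg h12.symm, if_true, update_self, update_of_ne h12, update_of_ne h23.symm,
      update_of_ne h24.symm]
    rw [show ω (tLink1 q) * g * (ω (tLink3 q))⁻¹ * (ω (tLink4 q))⁻¹ =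
      ω (tLink1 q) * (g * ((ω (tLink3 q))⁻¹ * (ω (tLink4 q))⁻¹ * ω (tLink1 q))) * (ω (tLink1 q))⁻¹ by group,
      hfconj]
  · simp only [if_neg h13.symm, if_neg h23.symm, if_true, update_self, update_of_ne h13, update_of_ne h23,
      update_of_ne h34.symm]
    rw [show ω (tLink1 q) * ω (tLink2 q) * g⁻¹ * (ω (tLink4 q))⁻¹ =
      ω (tLink4 q) * (g * ((ω (tLink2 q))⁻¹ * (ω (tLink1 q))⁻¹ * ω (tLink4 q)))⁻¹ * (ω (tLink4 q))⁻¹ by group,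
      hfconj, hfinv]
  · simp only [if_neg h14.symm, if_neg h24.symm, if_neg h34.symm, update_self, update_of_ne h14,
      update_of_ne h24, update_of_ne h34]
    rw [show ω (tLink1 q) * ω (tLink2 q) * (ω (tLink3 q))⁻¹ * g⁻¹ =
      (g * (ω (tLink3 q) * (ω (tLink2 q))⁻¹ * (ω (tLink1 q))⁻¹))⁻¹ by group, hfinv]

/-! ### §2 The one-link law of the perturbed plaquette action: the Wilson law re-weighted -/

/-- **One-link law of `∏_q v_β(U_q) e^{−f(U_q)}`**: for `v = v_β · e^{−f}` with `f` a continuous inversion-invariant class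
function, the conditional law of the link `e` given the exterior `ω` under `torusWeightSpec v` (`L ≥ 2`, `N ≥ 1`) is the
Wilson one-link law `ν_{B_ω}`, `B_ω = tField β e ω`, tilted by `−h_ω`, `h_ω(g) = Σ_{q ∋ e} f(g · T_q^e(ω))`
(`siteLaw_torusWeightSpec_eq_tilted_local`, `localLogWeight_update_eq`, `apply_tholonomy_update`). [folklore] -/
theorem siteLaw_plaquetteAction (hL : 1 < L) (hN : 1 ≤ N) (β : ℝ)
    {f : Matrix.specialUnitaryGroup (Fin N) ℂ → ℝ} (hfc : Continuous f)
    (hfconj : ∀ g h : Matrix.specialUnitaryGroup (Fin N) ℂ, f (g * h * g⁻¹) = f h)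
    (hfinv : ∀ h : Matrix.specialUnitaryGroup (Fin N) ℂ, f h⁻¹ = f h)
    {v : Matrix.specialUnitaryGroup (Fin N) ℂ → ℝ} (hvf : ∀ h, v h = wilsonPlaqWeight N β h * exp (-f h))
    (e : Edge d L) (ω : GaugeConfig d L (Matrix.specialUnitaryGroup (Fin N) ℂ)) :
    siteLaw (torusWeightSpec (d := d) (L := L) v) e ω =
      ((haarProbability (Matrix.specialUnitaryGroup (Fin N) ℂ)).tilted
        fun g => (N : ℝ) * ((g : Matrix (Fin N) (Fin N) ℂ) * tField β e ω).trace.re).tilted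
        fun g => -(∑ q ∈ plaqsThrough e, f (g * tstaple q e ω)) := by
  haveI : SecondCountableTopology (Matrix (Fin N) (Fin N) ℂ) :=
    inferInstanceAs (SecondCountableTopology (Fin N → Fin N → ℂ))
  haveI : SecondCountableTopology (Matrix.specialUnitaryGroup (Fin N) ℂ) :=
    Topology.IsEmbedding.subtypeVal.secondCountableTopology
  have hvc : Continuous v := by
    have : v = fun h => wilsonPlaqWeight N β h * exp (-f h) := funext hvf
    rw [this]
    exact (continuous_wilsonPlaqWeight (N := N) β).mul (continuous_exp.comp hfc.neg)
  rw [siteLaw_torusWeightSpec_eq_tilted_local hvc e ω]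
  have hlog : ∀ h, Real.log (v h) = Real.log (wilsonPlaqWeight N β h) + -f h := fun h => by
    rw [hvf h, Real.log_mul (wilsonPlaqWeight_pos (N := N) β h).ne' (exp_pos _).ne', Real.log_exp]
  have hsum : (fun g : Matrix.specialUnitaryGroup (Fin N) ℂ => ∑ q ∈ plaqsThrough e,
      Real.log (v (plaquetteHolonomy (update ω e g) q.1 q.2.1.1 q.2.1.2))) =
      fun g : Matrix.specialUnitaryGroup (Fin N) ℂ => -(β * N * (plaqsThrough e).card) +
        ((N : ℝ) * ((g : Matrix (Fin N) (Fin N) ℂ) * tField β e ω).trace.re +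
          -(∑ q ∈ plaqsThrough e, f (g * tstaple q e ω))) := by
    funext g
    simp_rw [hlog]
    rw [Finset.sum_add_distrib, localLogWeight_update_eq hL hN β e ω g, ← Finset.sum_neg_distrib, add_assoc]
    congr 2
    refine Finset.sum_congr rfl fun q hq => ?_
    rw [apply_tholonomy_update hL hfconj hfinv (mem_plaqsThrough.1 hq) ω g]
  rw [hsum, tilted_const_add_eq, su_tilted_linear_add]

/-! ### §3 The loads of the one-link perturbation `h_ω(g) = Σ_{q ∋ e} f(g · T_q^e(ω))` -/

/-- The number of plaquettes through a link is at most `2(d−1)`, as a real inequality. [folklore] -/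
theorem card_plaqsThrough_le_real (hd : 1 ≤ d) (e : Edge d L) :
    ((plaqsThrough e).card : ℝ) ≤ 2 * ((d : ℝ) - 1) := by
  calc ((plaqsThrough e).card : ℝ) ≤ ((2 * (d - 1) : ℕ) : ℝ) := by exact_mod_cast card_plaqsThrough_le e
    _ = 2 * ((d : ℝ) - 1) := by push_cast [Nat.cast_sub hd]; ring

/-- **Oscillation load**: `h_ω(g) − h_ω(g') ≤ 2(d−1) · a₀` whenever `f x − f y ≤ a₀` for all `x, y`. [folklore] -/
theorem hpert_osc_le (hd : 1 ≤ d) {f : Matrix.specialUnitaryGroup (Fin N) ℂ → ℝ} {a₀ : ℝ}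
    (hfosc : ∀ x y, f x - f y ≤ a₀) (e : Edge d L) (ω : GaugeConfig d L (Matrix.specialUnitaryGroup (Fin N) ℂ))
    (g g' : Matrix.specialUnitaryGroup (Fin N) ℂ) :
    (∑ q ∈ plaqsThrough e, f (g * tstaple q e ω)) - ∑ q ∈ plaqsThrough e, f (g' * tstaple q e ω) ≤
      2 * ((d : ℝ) - 1) * a₀ := by
  have ha0 : 0 ≤ a₀ := by simpa using hfosc g g
  rw [← Finset.sum_sub_distrib]
  calc ∑ q ∈ plaqsThrough e, (f (g * tstaple q e ω) - f (g' * tstaple q e ω))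
      ≤ ∑ _q ∈ plaqsThrough e, a₀ := Finset.sum_le_sum fun q _ => hfosc _ _
    _ = (plaqsThrough e).card * a₀ := by rw [Finset.sum_const, nsmul_eq_mul]
    _ ≤ 2 * ((d : ℝ) - 1) * a₀ := mul_le_mul_of_nonneg_right (card_plaqsThrough_le_real hd e) ha0

/-- **Self-Lipschitz load**: `|h_ω(g) − h_ω(g')| ≤ 2(d−1) λ ‖g − g'‖_F` whenever `f` is `λ`-Lipschitz (`λ ≥ 0`) — right
translation by the staple is a Frobenius isometry. [folklore] -/
theorem hpert_lip_le (hd : 1 ≤ d) {f : Matrix.specialUnitaryGroup (Fin N) ℂ → ℝ} {lam : ℝ} (hlam : 0 ≤ lam)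
    (hflip : ∀ x y, |f x - f y| ≤ lam * suFrobDist x y) (e : Edge d L)
    (ω : GaugeConfig d L (Matrix.specialUnitaryGroup (Fin N) ℂ)) (g g' : Matrix.specialUnitaryGroup (Fin N) ℂ) :
    |(∑ q ∈ plaqsThrough e, f (g * tstaple q e ω)) - ∑ q ∈ plaqsThrough e, f (g' * tstaple q e ω)| ≤
      2 * ((d : ℝ) - 1) * lam * suFrobDist g g' := by
  rw [← Finset.sum_sub_distrib]
  refine (Finset.abs_sum_le_sum_abs _ _).trans ?_
  have hterm : ∀ q ∈ plaqsThrough e, |f (g * tstaple q e ω) - f (g' * tstaple q e ω)| ≤ lam * suFrobDist g g' := by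
    intro q _
    have h := hflip (g * tstaple q e ω) (g' * tstaple q e ω)
    have hiso : suFrobDist (g * tstaple q e ω) (g' * tstaple q e ω) = suFrobDist g g' := by
      simpa only [one_mul] using suFrobDist_mul_mul 1 (tstaple q e ω) g g'
    rwa [hiso] at h
  calc ∑ q ∈ plaqsThrough e, |f (g * tstaple q e ω) - f (g' * tstaple q e ω)|
      ≤ ∑ _q ∈ plaqsThrough e, lam * suFrobDist g g' := Finset.sum_le_sum hterm
    _ = (plaqsThrough e).card * (lam * suFrobDist g g') := by rw [Finset.sum_const, nsmul_eq_mul]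
    _ ≤ 2 * ((d : ℝ) - 1) * (lam * suFrobDist g g') :=
        mul_le_mul_of_nonneg_right (card_plaqsThrough_le_real hd e) (mul_nonneg hlam (suFrobDist_nonneg _ _))
    _ = 2 * ((d : ℝ) - 1) * lam * suFrobDist g g' := by ring

/-- **Cross load**: if `ω = η` off the link `y`, then `|h_ω(g) − h_η(g)| ≤ λ · n(e, y) · ‖ω_y − η_y‖_F` with the torus
influence count `n = tInfluence` (the staples are `1`-Lipschitz in each of their links, `suFrobDist_tstaple_le`; left
translation by `g` is an isometry) — the perturbed influence runs through shared plaquettes only. [folklore] -/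
theorem hpert_cross_le (hL : 1 < L) {f : Matrix.specialUnitaryGroup (Fin N) ℂ → ℝ} {lam : ℝ} (hlam : 0 ≤ lam)
    (hflip : ∀ x y, |f x - f y| ≤ lam * suFrobDist x y) (e y : Edge d L)
    {ω η : GaugeConfig d L (Matrix.specialUnitaryGroup (Fin N) ℂ)} (hωη : ∀ z, z ≠ y → ω z = η z)
    (g : Matrix.specialUnitaryGroup (Fin N) ℂ) :
    |(∑ q ∈ plaqsThrough e, f (g * tstaple q e ω)) - ∑ q ∈ plaqsThrough e, f (g * tstaple q e η)| ≤
      lam * tInfluence e y * suFrobDist (ω y) (η y) := by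
  rw [← Finset.sum_sub_distrib]
  refine (Finset.abs_sum_le_sum_abs _ _).trans ?_
  rw [tInfluence, Nat.cast_sum, Finset.mul_sum, Finset.sum_mul]
  refine Finset.sum_le_sum fun q _ => ?_
  have h := hflip (g * tstaple q e ω) (g * tstaple q e η)
  have hiso : suFrobDist (g * tstaple q e ω) (g * tstaple q e η) = suFrobDist (tstaple q e ω) (tstaple q e η) := by
    simpa only [mul_one] using suFrobDist_mul_mul g 1 (tstaple q e ω) (tstaple q e η)
  rw [hiso] at h
  refine h.trans ?_
  have hst := suFrobDist_tstaple_le hL q e ω η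
  have hk : ∀ k : Fin 3, suFrobDist (ω (tstapleLinks q e k)) (η (tstapleLinks q e k)) =
      (if tstapleLinks q e k = y then 1 else 0 : ℕ) * suFrobDist (ω y) (η y) := by
    intro k
    by_cases hky : tstapleLinks q e k = y
    · rw [hky, if_pos rfl]; simp
    · rw [hωη _ hky, suFrobDist_self, if_neg hky]; simp
  simp_rw [hk] at hst
  rw [← Finset.sum_mul] at hst
  calc lam * suFrobDist (tstaple q e ω) (tstaple q e η)
      ≤ lam * ((∑ k : Fin 3, ((if tstapleLinks q e k = y then 1 else 0 : ℕ) : ℝ)) * suFrobDist (ω y) (η y)) :=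
        mul_le_mul_of_nonneg_left hst hlam
    _ = lam * ((∑ k : Fin 3, (if tstapleLinks q e k = y then 1 else 0 : ℕ) : ℕ) : ℝ) * suFrobDist (ω y) (η y) := by
        push_cast; ring

/-- The one-link perturbation `g ↦ Σ_{q ∋ e} f(g · T_q^e(ω))` is measurable (indeed continuous) for continuous `f`.
[folklore] -/
theorem measurable_hpert {f : Matrix.specialUnitaryGroup (Fin N) ℂ → ℝ} (hfc : Continuous f) (e : Edge d L)
    (ω : GaugeConfig d L (Matrix.specialUnitaryGroup (Fin N) ℂ)) :
    Measurable fun g : Matrix.specialUnitaryGroup (Fin N) ℂ => ∑ q ∈ plaqsThrough e, f (g * tstaple q e ω) := by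
  refine Continuous.measurable ?_
  exact continuous_finsetSum _ fun q _ => hfc.comp (continuous_id.mul continuous_const)

/-! ### §4 The robust single-link Dobrushin coefficients `c_eff · n(e, y)` of the perturbed plaquette action -/

/-- **Dobrushin's condition in Kantorovich–Rubinstein form for `∏_q v_β(U_q) e^{−f(U_q)}` on every torus of side
`≥ 2`, fed by ANY one-link modulus.**  Let `N ≥ 1`, `d ≥ 1`, `OneLinkKRModulus N R K` (`K ≥ 0`) on the tilt ball
`R ≥ 2(d−1)|β|/N`, and let `f` be a continuous inversion-invariant class function with `f x − f y ≤ a₀` and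
`|f x − f y| ≤ λ ‖x − y‖_F` (`λ ≥ 0`).  Then `torusWeightSpec v`, `v = v_β e^{−f}`, is a Kantorovich–Rubinstein contraction
for the Frobenius distance over the plaquette neighbours with coefficients `C(e, y) = c_eff · n(e, y)`,
`c_eff = K e^{2(d−1)a₀} (1 + 2√N · 2(d−1)λ) · |β|/N + √N λ` — Wilson's coefficient `K |β|/N` (`isKRContraction_torusWilson`)
times the re-weighting factor of `OneLinkTiltStability.su_oneLink_transfer`, plus the Grüss cross coefficient; SAME
support `n = tInfluence` as Wilson. [folklore] -/
theorem isKRContraction_plaquetteAction (hd : 1 ≤ d) (hN : 1 ≤ N) (hL : 1 < L) {β R K a₀ lam : ℝ}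
    (hK : 0 ≤ K) (hlam : 0 ≤ lam) (hR : |β| / N * (2 * ((d : ℝ) - 1)) ≤ R) (hmod : OneLinkKRModulus N R K)
    {f : Matrix.specialUnitaryGroup (Fin N) ℂ → ℝ} (hfc : Continuous f)
    (hfconj : ∀ g h : Matrix.specialUnitaryGroup (Fin N) ℂ, f (g * h * g⁻¹) = f h)
    (hfinv : ∀ h : Matrix.specialUnitaryGroup (Fin N) ℂ, f h⁻¹ = f h)
    (hfosc : ∀ x y, f x - f y ≤ a₀) (hflip : ∀ x y, |f x - f y| ≤ lam * suFrobDist x y)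
    {v : Matrix.specialUnitaryGroup (Fin N) ℂ → ℝ} (hvf : ∀ h, v h = wilsonPlaqWeight N β h * exp (-f h)) :
    IsKRContraction (torusWeightSpec (d := d) (L := L) v) suFrobDist linkNbrT fun e y =>
      (K * exp (2 * ((d : ℝ) - 1) * a₀) * (1 + 2 * Real.sqrt N * (2 * ((d : ℝ) - 1) * lam)) * (|β| / N) +
        Real.sqrt N * lam) * (tInfluence e y : ℝ) := by
  haveI : SecondCountableTopology (Matrix (Fin N) (Fin N) ℂ) :=
    inferInstanceAs (SecondCountableTopology (Fin N → Fin N → ℂ))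
  haveI : SecondCountableTopology (Matrix.specialUnitaryGroup (Fin N) ℂ) :=
    Topology.IsEmbedding.subtypeVal.secondCountableTopology
  have hvc : Continuous v := by
    have : v = fun h => wilsonPlaqWeight N β h * exp (-f h) := funext hvf
    rw [this]
    exact (continuous_wilsonPlaqWeight (N := N) β).mul (continuous_exp.comp hfc.neg)
  have hd0 : (0 : ℝ) ≤ (d : ℝ) - 1 := by
    have : (1 : ℝ) ≤ d := by exact_mod_cast hd
    linarith
  have ha0 : 0 ≤ a₀ := by simpa using hfosc 1 1
  refine ⟨not_mem_linkNbrT, fun e y => by positivity,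
    fun e η η' h => siteLaw_torusWeightSpec_congr hvc e h, fun e y _ ω η hωη φ L' hφm hφb hL' hφL => ?_⟩
  rw [siteLaw_plaquetteAction hL hN β hfc hfconj hfinv hvf e ω, siteLaw_plaquetteAction hL hN β hfc hfconj hfinv hvf e η]
  have hBω := (matrixOpNorm_tField_le hd hN β e ω).trans hR
  have hBη := (matrixOpNorm_tField_le hd hN β e η).trans hR
  have key := su_oneLink_robust_influence (N := N) (δ := 2 * ((d : ℝ) - 1) * a₀) (ℓ := 2 * ((d : ℝ) - 1) * lam)
    (s := lam * tInfluence e y * suFrobDist (ω y) (η y)) (by positivity) hmod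
    (tField β e ω) (tField β e η) hBω hBη
    (fun g => ∑ q ∈ plaqsThrough e, f (g * tstaple q e ω)) (fun g => ∑ q ∈ plaqsThrough e, f (g * tstaple q e η))
    (measurable_hpert hfc e ω) (measurable_hpert hfc e η)
    (su_exists_abs_le_of_osc (hpert_osc_le hd hfosc e η))
    (hpert_osc_le hd hfosc e ω) (hpert_lip_le hd hlam hflip e ω) (hpert_cross_le hL hlam hflip e y hωη)
    φ L' hφm hφb hL' hφL
  refine key.trans ?_
  have hΔB : frobNorm (tField β e ω - tField β e η) ≤ |β| / N * tInfluence e y * suFrobDist (ω y) (η y) :=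
    frobNorm_tField_sub_le hL β e y hωη
  have hT : 0 ≤ K * exp (2 * ((d : ℝ) - 1) * a₀) * (1 + 2 * Real.sqrt N * (2 * ((d : ℝ) - 1) * lam)) := by
    positivity
  calc (K * exp (2 * ((d : ℝ) - 1) * a₀) * (1 + 2 * Real.sqrt N * (2 * ((d : ℝ) - 1) * lam)) *
          frobNorm (tField β e ω - tField β e η) + Real.sqrt N * (lam * tInfluence e y * suFrobDist (ω y) (η y))) * L'
      ≤ (K * exp (2 * ((d : ℝ) - 1) * a₀) * (1 + 2 * Real.sqrt N * (2 * ((d : ℝ) - 1) * lam)) *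
          (|β| / N * tInfluence e y * suFrobDist (ω y) (η y)) +
          Real.sqrt N * (lam * tInfluence e y * suFrobDist (ω y) (η y))) * L' := by
        gcongr
    _ = (K * exp (2 * ((d : ℝ) - 1) * a₀) * (1 + 2 * Real.sqrt N * (2 * ((d : ℝ) - 1) * lam)) * (|β| / N) +
          Real.sqrt N * lam) * (tInfluence e y : ℝ) * L' * suFrobDist (ω y) (η y) := by ring

/-! ### §5 The robust star window and torus clustering for the perturbed plaquette action -/

/-- **The robust STAR WINDOW (crux Y2-X2, plaquette-local members)**: under the hypotheses of
`isKRContraction_plaquetteAction` with `d ≥ 2`, torus side `L ≥ 3` and the door polynomial condition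
`doorPoly d c_eff < 1` at the EFFECTIVE coefficient `c_eff`, the four window clauses of Lemma G hold for
`torusWeightSpec (v_β e^{−f})` with the array `Karr c_eff` and per-star received sum `R_G^{(d)}(c_eff)`
(`StarLemmaGWeight.star_window_of_isKRContraction`: the class-function property of `v_β e^{−f}` is the gauge trick's
only requirement). [folklore] -/
theorem plaquetteAction_star_window (hd : 2 ≤ d) (hN : 1 ≤ N) (hL : 3 ≤ L) {β R K a₀ lam : ℝ}
    (hK : 0 ≤ K) (hlam : 0 ≤ lam) (hR : |β| / N * (2 * ((d : ℝ) - 1)) ≤ R) (hmod : OneLinkKRModulus N R K)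
    {f : Matrix.specialUnitaryGroup (Fin N) ℂ → ℝ} (hfc : Continuous f)
    (hfconj : ∀ g h : Matrix.specialUnitaryGroup (Fin N) ℂ, f (g * h * g⁻¹) = f h)
    (hfinv : ∀ h : Matrix.specialUnitaryGroup (Fin N) ℂ, f h⁻¹ = f h)
    (hfosc : ∀ x y, f x - f y ≤ a₀) (hflip : ∀ x y, |f x - f y| ≤ lam * suFrobDist x y)
    {v : Matrix.specialUnitaryGroup (Fin N) ℂ → ℝ} (hvf : ∀ h, v h = wilsonPlaqWeight N β h * exp (-f h))
    {c : ℝ} (hc : c = K * exp (2 * ((d : ℝ) - 1) * a₀) * (1 + 2 * Real.sqrt N * (2 * ((d : ℝ) - 1) * lam)) *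
      (|β| / N) + Real.sqrt N * lam) (hcd : doorPoly d c < 1) :
    (∀ s y x, 0 ≤ Karr (L := L) (d := d) c s y x) ∧
      (∀ (s : Site d L) y x, Karr c s y x ≠ 0 → ∀ w ∈ linkEnds y, torusNorm (s - w) ≤ 1) ∧
      IsLinkWindowContraction (d := d) (L := L) v suFrobDist starWin (fun e => Karr c e.1) ∧
      ∀ (s : Site d L) (x : Edge d L), x ∈ vertexStar s → ∑ y, Karr c s y x = gaugeR d c := by
  have hd1 : 1 ≤ d := by omega
  have hvc : Continuous v := by
    have : v = fun h => wilsonPlaqWeight N β h * exp (-f h) := funext hvf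
    rw [this]
    exact (continuous_wilsonPlaqWeight (N := N) β).mul (continuous_exp.comp hfc.neg)
  have hv0 : ∀ h, 0 < v h := fun h => by rw [hvf h]; exact mul_pos (wilsonPlaqWeight_pos (N := N) β h) (exp_pos _)
  have hvconj : ∀ g h : Matrix.specialUnitaryGroup (Fin N) ℂ, v (g * h * g⁻¹) = v h := fun g h => by
    rw [hvf, hvf, wilsonPlaqWeight_conj β, hfconj]
  have ha0 : 0 ≤ a₀ := by simpa using hfosc 1 1
  have hd0 : (0 : ℝ) ≤ (d : ℝ) - 1 := by
    have : (2 : ℝ) ≤ d := by exact_mod_cast hd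
    linarith
  have hc0 : 0 ≤ c := by rw [hc]; positivity
  have hKR := isKRContraction_plaquetteAction (d := d) (L := L) hd1 hN (by omega) hK hlam hR hmod hfc hfconj hfinv
    hfosc hflip hvf
  rw [← hc] at hKR
  exact StarLemmaGWeight.star_window_of_isKRContraction hd hL hvc hv0 hvconj hc0 hcd hKR

/-- **TORUS CLUSTERING FOR THE PERTURBED PLAQUETTE ACTION, uniform in the side.**  Under the hypotheses of
`plaquetteAction_star_window`: for the torus measure `Z⁻¹ ∏_q v_β(U_q) e^{−f(U_q)} ∏_e dU_e` on `(ℤ/L)^d` (`L ≥ 3`;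
`groupHeatKernelMeasure (fun _ => v) 0`, a Gibbs measure of `torusWeightSpec v`) and admissible link observables `F, G`
(bounded measurable, local, link-Lipschitz for the Frobenius distance) whose supports' endpoints are `≥ L₀` apart in
the periodic sup-distance,
`|cov(F, G)| ≤ 4 (2√N)² exp(−(1 − ρ)² L₀ / (2(2ρ · 2d + 1))) (Σ δF)(Σ δG)`, `ρ = R_G^{(d)}(c_eff) < 1` — exponential
clustering with constants depending on `(d, N, c_eff)` only, i.e. UNIFORMLY in `L`: the SC-a currency on the plaquette-local
ball (`DSWindow.star_abs_covariance_le` on the robust star window).  At `f = 0` this is the cell's Wilson star row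
(`c_eff = K|β|/N`; `SU(2)`, `d = 4`: every `β_W < 9/25`). [folklore] -/
theorem plaquetteAction_abs_covariance_le (hd : 2 ≤ d) (hN : 1 ≤ N) (hL : 3 ≤ L) {β R K a₀ lam : ℝ}
    (hK : 0 ≤ K) (hlam : 0 ≤ lam) (hR : |β| / N * (2 * ((d : ℝ) - 1)) ≤ R) (hmod : OneLinkKRModulus N R K)
    {f : Matrix.specialUnitaryGroup (Fin N) ℂ → ℝ} (hfc : Continuous f)
    (hfconj : ∀ g h : Matrix.specialUnitaryGroup (Fin N) ℂ, f (g * h * g⁻¹) = f h)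
    (hfinv : ∀ h : Matrix.specialUnitaryGroup (Fin N) ℂ, f h⁻¹ = f h)
    (hfosc : ∀ x y, f x - f y ≤ a₀) (hflip : ∀ x y, |f x - f y| ≤ lam * suFrobDist x y)
    {v : Matrix.specialUnitaryGroup (Fin N) ℂ → ℝ} (hvf : ∀ h, v h = wilsonPlaqWeight N β h * exp (-f h))
    {c : ℝ} (hc : c = K * exp (2 * ((d : ℝ) - 1) * a₀) * (1 + 2 * Real.sqrt N * (2 * ((d : ℝ) - 1) * lam)) *
      (|β| / N) + Real.sqrt N * lam) (hcd : doorPoly d c < 1)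
    {F G : GaugeConfig d L (Matrix.specialUnitaryGroup (Fin N) ℂ) → ℝ} {ΔF ΔG : Finset (Edge d L)}
    {δF δG : Edge d L → ℝ} (hF : LinkObs suFrobDist F ΔF δF) (hG : LinkObs suFrobDist G ΔG δG) (L₀ : ℕ)
    (hL₀ : ∀ x ∈ ΔF, ∀ z ∈ ΔG, ∀ a ∈ linkEnds x, ∀ w ∈ linkEnds z, L₀ ≤ torusNorm (a - w)) :
    |cov[F, G; groupHeatKernelMeasure (d := d) (L := L) (fun _ : ℝ => v) 0]| ≤
      4 * (2 * Real.sqrt N) ^ 2 *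
        Real.exp (-((1 - gaugeR d c) ^ 2 / (2 * (2 * gaugeR d c * (2 * d : ℕ) + 1)) * L₀)) *
        (∑ x ∈ ΔF, δF x) * ∑ y ∈ ΔG, δG y := by
  haveI : SecondCountableTopology (Matrix (Fin N) (Fin N) ℂ) :=
    inferInstanceAs (SecondCountableTopology (Fin N → Fin N → ℂ))
  haveI : SecondCountableTopology (Matrix.specialUnitaryGroup (Fin N) ℂ) :=
    Topology.IsEmbedding.subtypeVal.secondCountableTopology
  have hvc : Continuous v := by
    have : v = fun h => wilsonPlaqWeight N β h * exp (-f h) := funext hvf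
    rw [this]
    exact (continuous_wilsonPlaqWeight (N := N) β).mul (continuous_exp.comp hfc.neg)
  have hv0 : ∀ h, 0 < v h := fun h => by rw [hvf h]; exact mul_pos (wilsonPlaqWeight_pos (N := N) β h) (exp_pos _)
  have ha0 : 0 ≤ a₀ := by simpa using hfosc 1 1
  have hd0 : (0 : ℝ) ≤ (d : ℝ) - 1 := by
    have : (2 : ℝ) ≤ d := by exact_mod_cast hd
    linarith
  have hc0 : 0 ≤ c := by rw [hc]; positivity
  obtain ⟨h1, h2, h3, h4⟩ := plaquetteAction_star_window (d := d) (L := L) hd hN hL hK hlam hR hmod hfc hfconj hfinv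
    hfosc hflip hvf hc hcd
  have hρ : 0 ≤ gaugeR d c ∧ gaugeR d c < 1 := gaugeR_lt_one_of_door hd hc0 hcd
  exact star_abs_covariance_le hvc hv0 (r := suFrobDist) (R := 2 * Real.sqrt N) (by positivity) suFrobDist_le h1 h2 h3
    hρ.1 hρ.2 (fun s x hx => (h4 s x hx).le) hF hG L₀ hL₀

end Summit.Ventures.YMGap.PlaquetteActionWindow
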